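import Literature.NumberTheory.Transcendental.CijsouwWaldschmidt1977Steps
import HarnessLib

/-!
# Waldschmidt 1980, §3.2 over `ℚ` (`q = 2`): the parameters

Support file (plain definitions and theorems; no named facts) for the archimedean input of the
Stewart–Yu 1991 line of `Literature.Barriers.ABC.stewartYu1991_upperBound` (M. Waldschmidt,
*A lower bound for linear forms in logarithms*, Acta Arith. **37** (1980), Prop. 3.8 over `ℚ`,
`q = 2`, `D = 1`).

With `m = d + 1` logarithms — `d ≥ 1` free ones of sizes `Vⱼ ≥ 1` (all `≤ V_f`) and the eliminated
one `θ` of the LARGEST size `V_θ ≥ V_f` — and a coefficient bound `W ≥ 1`, Waldschmidt's parameters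
((3.2), p. 264, with `D = 1`, `q = 2`, `E₁ = 4`, and generous absolute constants in place of
`c₀, …, c₄`) are

* `W⋆ = max(W, m log(2¹³ m V_θ))` (his `W*`), `G = m log(2¹⁷ m V_f)` (his `log V*_{n−1}`),
* `U = Aᵐ · m^{2m+1}/m! · (∏ Vⱼ) V_θ · W⋆ · G` (his `U₂ ∝ c₂ⁿ n^{2n+1} (n!)⁻¹ V₁⋯Vₙ W* log V*_{n−1}`),
* `S₀ = 2⌊c_S m W⋆⌋` points (even), `T = ⌊U/(c_T 2ᵐ W⋆)⌋` derivatives, `h = ⌊W⋆/G⌋ + 1` and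
  `L_b = ⌊U/(c_L 2ᵐ G h)⌋ + 1` for the `Δ`-polynomials `Δ(X; r)Δ(X; h)ˡ` (`r < h`, `l < L_b`; his
  `L₋₁ + 1 ∝ W*`, `L₀`), and the exponent ranges `Lⱼ = ⌊U/(c_L' m 2^{m+1} S₀ Vⱼ)⌋`,
  `L_θ = ⌊U/(c_L' m 2^{m+1} S₀ V_θ)⌋` (DIFFERENT for different `j`; `L_θ` is the smallest),
* `J₀ = [log₂ L_θ] + 1` descent steps (so `L_θ < 2^{J₀} ≤ 2 L_θ`).

The choice `h ≍ W⋆/G` (rather than `W⋆`) makes Baker's point-dependent `ν(x, h)` — built into the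
`Δ`-factors `qΔ` of the tree's Cijsouw–Waldschmidt files — affordable: `T h log((x+h)/h) ≪ U/2ᵐ`.
This file fixes the constants and proves the elementary inequalities between the parameters used
by the size estimates and the assembly.

## References

* [Waldschmidt1980] M. Waldschmidt, *A lower bound for linear forms in logarithms*, Acta Arith. 37
  (1980), 257–283 — §3.1–3.2 (pp. 263–265).
-/

noncomputable section

open Finset Real

namespace Literature.NumberTheory.Transcendental.Waldschmidt1980

/-- **The parameters of Waldschmidt's Proposition 3.1 over `ℚ`.** `d ≥ 1` free logarithms of
sizes `1 ≤ Vⱼ ≤ V_f`, the eliminated one of size `V_θ ≥ V_f`, and the coefficient bound `W ≥ 1`.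
[cite: Waldschmidt1980, §3.1–3.2 (pp. 263–264)] -/
structure W80Par (d : ℕ) where
  /-- sizes of the free logarithms (`Vⱼ ≥ max(h(αⱼ), |log αⱼ|)`) -/
  V : Fin d → ℝ
  /-- a common bound for the free sizes (Waldschmidt's `V_{n-1}`) -/
  Vf : ℝ
  /-- the size of the eliminated logarithm (Waldschmidt's `Vₙ`, the largest) -/
  Vθ : ℝ
  /-- the coefficient bound (`W ≥ log max |bⱼ|`) -/
  W : ℝ
  /-- `Vⱼ ≥ 1` -/
  hV : ∀ j, 1 ≤ V j
  /-- `Vⱼ ≤ V_f` -/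
  hVf : ∀ j, V j ≤ Vf
  /-- `1 ≤ V_f` -/
  hVf1 : 1 ≤ Vf
  /-- `V_f ≤ V_θ` -/
  hVfθ : Vf ≤ Vθ
  /-- `W ≥ 1` -/
  hW : 1 ≤ W
  /-- at least one free logarithm -/
  hd : 1 ≤ d

namespace W80Par

variable {d : ℕ} (P : W80Par d)

/-! ### The constants -/

/-- `c_T = 2¹⁴`. [folklore] -/
def cT : ℝ := 2 ^ 14
/-- `c_S = 2¹³` (`c_S/c_T = 1/2`). [folklore] -/
def cS : ℝ := 2 ^ 13
/-- `c_L = 2¹⁴`. [folklore] -/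
def cL : ℝ := 2 ^ 14
/-- `c_L' = 2¹²`. [folklore] -/
def cL' : ℝ := 2 ^ 12
/-- `A = 2⁵⁰` (the base of the constant `Aᵐ`). [folklore] -/
def A : ℝ := 2 ^ 50

/-! ### The derived parameters -/

/-- The number of logarithms `m = d + 1`, as a real number. [folklore] -/
def mR (d : ℕ) : ℝ := (d : ℝ) + 1

/-- `W⋆ = max(W, m log(2¹³ m V_θ))` (Waldschmidt's `W*`, (3.2)). [cite: Waldschmidt1980, §3.2 (p. 264)] -/
def Wstar : ℝ := max P.W (mR d * Real.log (2 ^ 13 * mR d * P.Vθ))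

/-- `G = m log(2¹⁷ m V_f)` (Waldschmidt's `log V*_{n−1}`, (3.2)). [cite: Waldschmidt1980, §3.2 (p. 264)] -/
def G : ℝ := mR d * Real.log (2 ^ 17 * mR d * P.Vf)

/-- **`U = Aᵐ · m^{2m+1}/m! · (∏ Vⱼ) V_θ · W⋆ · G`** (Waldschmidt's `U₂`, p. 264).
[cite: Waldschmidt1980, §3.1 (p. 264)] -/
def U : ℝ := A ^ (d + 1) * (mR d ^ (2 * d + 3) / (d + 1).factorial) * ((∏ j, P.V j) * P.Vθ) *
  P.Wstar * P.G

/-- `S₀ = 2 ⌊c_S m W⋆⌋` (even; the points of level `0` are the odd `s < S₀`). [cite: Waldschmidt1980, (3.2) p. 264] -/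
def S₀ : ℕ := 2 * ⌊cS * mR d * P.Wstar⌋₊

/-- `T = ⌊U/(c_T 2ᵐ W⋆)⌋`. [cite: Waldschmidt1980, (3.2) p. 264] -/
def T : ℕ := ⌊P.U / (cT * 2 ^ (d + 1) * P.Wstar)⌋₊

/-- `h = ⌊W⋆/G⌋ + 1` (the block length of the `Δ`-polynomials, Waldschmidt's `L₋₁ + 1`).
[cite: Waldschmidt1980, (3.2) p. 264] -/
def hpar : ℕ := ⌊P.Wstar / P.G⌋₊ + 1

/-- `L_b = ⌊U/(c_L 2ᵐ G h)⌋ + 1` (the number of blocks, Waldschmidt's `L₀ + 1`). [cite: Waldschmidt1980, (3.2) p. 264] -/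
def Lb : ℕ := ⌊P.U / (cL * 2 ^ (d + 1) * P.G * P.hpar)⌋₊ + 1

/-- `Lⱼ = ⌊U/(c_L' m 2^{m+1} S₀ Vⱼ)⌋`. [cite: Waldschmidt1980, (3.2) p. 264] -/
def L (j : Fin d) : ℕ := ⌊P.U / (cL' * mR d * 2 ^ (d + 2) * P.S₀ * P.V j)⌋₊

/-- `L_θ = ⌊U/(c_L' m 2^{m+1} S₀ V_θ)⌋` (the smallest range). [cite: Waldschmidt1980, (3.2) p. 264] -/
def Lθ : ℕ := ⌊P.U / (cL' * mR d * 2 ^ (d + 2) * P.S₀ * P.Vθ)⌋₊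

/-- `J₀ = [log₂ L_θ] + 1` descent steps. [cite: Waldschmidt1980, §3.5 (p. 274)] -/
def J₀ : ℕ := Nat.log 2 P.Lθ + 1

/-! ### Elementary inequalities -/

/-- `1 ≤ m`, `2 ≤ m`. [folklore] -/
theorem two_le_mR (P : W80Par d) : (2 : ℝ) ≤ mR d := by
  have h1 : (1 : ℝ) ≤ d := by exact_mod_cast P.hd
  unfold mR
  linarith

/-- `0 < m`. [folklore] -/
theorem mR_pos (P : W80Par d) : (0 : ℝ) < mR d := by linarith [(two_le_mR P)]

/-- `1 ≤ V_θ`. [folklore] -/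
theorem one_le_Vθ : (1 : ℝ) ≤ P.Vθ := P.hVf1.trans P.hVfθ

/-- `W⋆ ≥ W ≥ 1`. [folklore] -/
theorem W_le_Wstar : P.W ≤ P.Wstar := le_max_left _ _

/-- `1 ≤ W⋆`. [folklore] -/
theorem one_le_Wstar : (1 : ℝ) ≤ P.Wstar := P.hW.trans P.W_le_Wstar

/-- `W⋆ ≥ m log(2¹³ m V_θ)`. [folklore] -/
theorem mlog_le_Wstar : mR d * Real.log (2 ^ 13 * mR d * P.Vθ) ≤ P.Wstar := le_max_right _ _

/-- `log(2¹³ m V_θ) ≥ 9` (`2¹³ · 2 = 2¹⁴ ≥ e⁹`). [folklore] -/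
theorem nine_le_log : (9 : ℝ) ≤ Real.log (2 ^ 13 * mR d * P.Vθ) := by
  have h1 : (2 : ℝ) ^ 14 ≤ 2 ^ 13 * mR d * P.Vθ := by
    have := (two_le_mR P); have := P.one_le_Vθ
    calc (2 : ℝ) ^ 14 = 2 ^ 13 * 2 * 1 := by norm_num
      _ ≤ 2 ^ 13 * mR d * P.Vθ := by gcongr
  have h2 : Real.exp 9 ≤ (2 : ℝ) ^ 14 := by
    have := Real.exp_one_lt_d9
    calc Real.exp 9 = Real.exp 1 ^ 9 := by rw [← Real.exp_nat_mul]; norm_num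
      _ ≤ (2.7182818286 : ℝ) ^ 9 := by gcongr
      _ ≤ 2 ^ 14 := by norm_num
  calc (9 : ℝ) = Real.log (Real.exp 9) := (Real.log_exp 9).symm
    _ ≤ Real.log (2 ^ 13 * mR d * P.Vθ) := Real.log_le_log (Real.exp_pos _) (h2.trans h1)

/-- `W⋆ ≥ 9m ≥ 18`. [folklore] -/
theorem nine_mR_le_Wstar : 9 * mR d ≤ P.Wstar := by
  have h := P.mlog_le_Wstar
  have h9 := P.nine_le_log
  have hm := (mR_pos P)
  nlinarith

/-- `log(2¹⁷ m V_f) ≥ 11` (`2¹⁸ ≥ e¹¹`). [folklore] -/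
theorem eleven_le_logG : (11 : ℝ) ≤ Real.log (2 ^ 17 * mR d * P.Vf) := by
  have h1 : (2 : ℝ) ^ 18 ≤ 2 ^ 17 * mR d * P.Vf := by
    have := (two_le_mR P); have := P.hVf1
    calc (2 : ℝ) ^ 18 = 2 ^ 17 * 2 * 1 := by norm_num
      _ ≤ 2 ^ 17 * mR d * P.Vf := by gcongr
  have h2 : Real.exp 11 ≤ (2 : ℝ) ^ 18 := by
    have := Real.exp_one_lt_d9
    calc Real.exp 11 = Real.exp 1 ^ 11 := by rw [← Real.exp_nat_mul]; norm_num
      _ ≤ (2.7182818286 : ℝ) ^ 11 := by gcongr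
      _ ≤ 2 ^ 18 := by norm_num
  calc (11 : ℝ) = Real.log (Real.exp 11) := (Real.log_exp 11).symm
    _ ≤ Real.log (2 ^ 17 * mR d * P.Vf) := Real.log_le_log (Real.exp_pos _) (h2.trans h1)

/-- `G ≥ 11 m ≥ 22`. [folklore] -/
theorem eleven_mR_le_G : 11 * mR d ≤ P.G := by
  unfold G; have := P.eleven_le_logG; have := (mR_pos P); nlinarith

/-- `0 < G`. [folklore] -/
theorem G_pos : 0 < P.G := by have := P.eleven_mR_le_G; have := (mR_pos P); nlinarith

/-- **`G ≤ 2 W⋆`**: `2¹⁷ m V_f ≤ (2¹³ m V_θ)²`. [folklore] -/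
theorem G_le_two_Wstar : P.G ≤ 2 * P.Wstar := by
  have hm := (two_le_mR P)
  have hVθ := P.one_le_Vθ
  have h1 : (2 : ℝ) ^ 17 * mR d * P.Vf ≤ (2 ^ 13 * mR d * P.Vθ) ^ 2 := by
    have hVf0 : P.Vf ≤ P.Vθ := P.hVfθ
    have hm1 : 1 ≤ mR d := by linarith
    have hVf1 := P.hVf1
    have e : (2 ^ 13 * mR d * P.Vθ) ^ 2 = (2 : ℝ) ^ 26 * ((mR d * mR d) * (P.Vθ * P.Vθ)) := by ring
    rw [e]
    have h2 : mR d * P.Vf ≤ (mR d * mR d) * (P.Vθ * P.Vθ) := by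
      calc mR d * P.Vf ≤ mR d * P.Vθ := mul_le_mul_of_nonneg_left hVf0 (by linarith)
        _ = (mR d * 1) * (P.Vθ * 1) := by ring
        _ ≤ (mR d * mR d) * (P.Vθ * P.Vθ) := by gcongr
    calc (2 : ℝ) ^ 17 * mR d * P.Vf = 2 ^ 17 * (mR d * P.Vf) := by ring
      _ ≤ 2 ^ 26 * (mR d * P.Vf) := by gcongr <;> norm_num
      _ ≤ 2 ^ 26 * ((mR d * mR d) * (P.Vθ * P.Vθ)) := by gcongr
  have hpos : (0 : ℝ) < 2 ^ 17 * mR d * P.Vf := by have := P.hVf1; positivity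
  calc P.G = mR d * Real.log (2 ^ 17 * mR d * P.Vf) := rfl
    _ ≤ mR d * Real.log ((2 ^ 13 * mR d * P.Vθ) ^ 2) :=
        mul_le_mul_of_nonneg_left (Real.log_le_log hpos h1) (mR_pos P).le
    _ = 2 * (mR d * Real.log (2 ^ 13 * mR d * P.Vθ)) := by rw [Real.log_pow]; push_cast; ring
    _ ≤ 2 * P.Wstar := by linarith [P.mlog_le_Wstar]

/-- `0 < U`. [folklore] -/
theorem U_pos : 0 < P.U := by
  unfold U A
  have := P.one_le_Wstar; have := P.G_pos; have := P.one_le_Vθ; have := (mR_pos P)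
  have hV : 0 < ∏ j, P.V j := prod_pos fun j _ => lt_of_lt_of_le one_pos (P.hV j)
  positivity

/-- **The size of the unit `U/2ᵐ`**: `U/(2ᵐ W⋆) ≥ 2^{49m} · G · (∏ Vⱼ) V_θ ≥ 2^{49m}`
(`m^{2m+1}/m! ≥ 1`). [folklore] -/
theorem U_div_ge : (2 : ℝ) ^ (49 * (d + 1)) * P.G * ((∏ j, P.V j) * P.Vθ) * P.Wstar ≤ P.U / 2 ^ (d + 1) := by
  unfold U A
  rw [le_div_iff₀ (by positivity)]
  have hfac : (1 : ℝ) ≤ mR d ^ (2 * d + 3) / (d + 1).factorial := by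
    rw [le_div_iff₀ (by positivity), one_mul]
    have h1 : ((d + 1).factorial : ℝ) ≤ ((d + 1 : ℕ) : ℝ) ^ (d + 1) := by
      exact_mod_cast Nat.factorial_le_pow (d + 1)
    have h2 : ((d + 1 : ℕ) : ℝ) ^ (d + 1) ≤ mR d ^ (2 * d + 3) := by
      have hm : ((d + 1 : ℕ) : ℝ) = mR d := by unfold mR; push_cast; ring
      rw [hm]
      exact pow_le_pow_right₀ (by linarith [(two_le_mR P)]) (by omega)
    exact h1.trans h2
  have hW := P.one_le_Wstar; have hG := P.G_pos; have hVθ := P.one_le_Vθ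
  have hV : 1 ≤ ∏ j, P.V j := by
    have : ∏ _j : Fin d, (1 : ℝ) ≤ ∏ j, P.V j :=
      prod_le_prod (fun _ _ => zero_le_one) fun j _ => P.hV j
    simpa using this
  have hVV : 0 ≤ (∏ j, P.V j) * P.Vθ := by positivity
  have hpow : (2 : ℝ) ^ (49 * (d + 1)) * 2 ^ (d + 1) = (2 ^ 50) ^ (d + 1) := by
    rw [← pow_mul, ← pow_add]; congr 1; ring
  calc (2 : ℝ) ^ (49 * (d + 1)) * P.G * ((∏ j, P.V j) * P.Vθ) * P.Wstar * 2 ^ (d + 1)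
      = (2 ^ 50) ^ (d + 1) * 1 * ((∏ j, P.V j) * P.Vθ) * P.Wstar * P.G := by rw [← hpow]; ring
    _ ≤ (2 ^ 50) ^ (d + 1) * (mR d ^ (2 * d + 3) / (d + 1).factorial) * ((∏ j, P.V j) * P.Vθ) *
          P.Wstar * P.G := by gcongr

/-- `U/(2ᵐ W⋆) ≥ 2^{49m}` (a convenient weak form). [folklore] -/
theorem U_div_ge' : (2 : ℝ) ^ (49 * (d + 1)) ≤ P.U / (2 ^ (d + 1) * P.Wstar) := by
  have h := P.U_div_ge
  have hW := P.one_le_Wstar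
  have hG : 1 ≤ P.G := by have := P.eleven_mR_le_G; have := (two_le_mR P); nlinarith
  have hV : 1 ≤ (∏ j, P.V j) * P.Vθ := by
    have h1 : 1 ≤ ∏ j, P.V j := by
      have : ∏ _j : Fin d, (1 : ℝ) ≤ ∏ j, P.V j :=
        prod_le_prod (fun _ _ => zero_le_one) fun j _ => P.hV j
      simpa using this
    nlinarith [P.one_le_Vθ]
  rw [le_div_iff₀ (by positivity)]
  rw [le_div_iff₀ (by positivity)] at h
  have h49 : (0 : ℝ) ≤ 2 ^ (49 * (d + 1)) := by positivity
  calc (2 : ℝ) ^ (49 * (d + 1)) * (2 ^ (d + 1) * P.Wstar)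
      = 2 ^ (49 * (d + 1)) * 1 * 1 * P.Wstar * 2 ^ (d + 1) := by ring
    _ ≤ 2 ^ (49 * (d + 1)) * P.G * ((∏ j, P.V j) * P.Vθ) * P.Wstar * 2 ^ (d + 1) := by gcongr
    _ ≤ P.U := h

/-! ### `S₀`, `T` -/

/-- `S₀` is even. [folklore] -/
theorem even_S₀ : Even P.S₀ := ⟨⌊cS * mR d * P.Wstar⌋₊, by unfold S₀; ring⟩

/-- `c_S m W⋆ ≥ 2¹⁴`. [folklore] -/
theorem cS_mul_ge : (2 : ℝ) ^ 14 ≤ cS * mR d * P.Wstar := by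
  unfold cS
  have := (two_le_mR P); have := P.one_le_Wstar
  calc (2 : ℝ) ^ 14 = 2 ^ 13 * 2 * 1 := by norm_num
    _ ≤ 2 ^ 13 * mR d * P.Wstar := by gcongr

/-- `S₀ ≤ 2 c_S m W⋆`. [folklore] -/
theorem S₀_le : (P.S₀ : ℝ) ≤ 2 * (cS * mR d * P.Wstar) := by
  unfold S₀
  push_cast
  have := Nat.floor_le (show 0 ≤ cS * mR d * P.Wstar by have := P.cS_mul_ge; linarith)
  linarith

/-- `c_S m W⋆ ≤ S₀` (indeed `S₀ ≥ 2 c_S m W⋆ − 2`). [folklore] -/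
theorem S₀_ge : cS * mR d * P.Wstar ≤ P.S₀ := by
  unfold S₀
  push_cast
  have h1 := Nat.lt_floor_add_one (cS * mR d * P.Wstar)
  have h2 := P.cS_mul_ge
  linarith

/-- `2 ≤ S₀`. [folklore] -/
theorem two_le_S₀ : 2 ≤ P.S₀ := by
  have h := P.S₀_ge
  have h2 := P.cS_mul_ge
  have : (2 : ℝ) ≤ P.S₀ := by linarith
  exact_mod_cast this

/-- `0 < S₀` (real). [folklore] -/
theorem S₀_pos : (0 : ℝ) < P.S₀ := by have := P.two_le_S₀; exact_mod_cast (by omega : 0 < P.S₀)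

/-- `T ≤ U/(c_T 2ᵐ W⋆)`. [folklore] -/
theorem T_le : (P.T : ℝ) ≤ P.U / (cT * 2 ^ (d + 1) * P.Wstar) := by
  unfold T
  exact Nat.floor_le (by unfold cT; have := P.U_pos; have := P.one_le_Wstar; positivity)

/-- `U/(c_T 2ᵐ W⋆) ≥ 2`. [folklore] -/
theorem two_le_U_div_cT : (2 : ℝ) ≤ P.U / (cT * 2 ^ (d + 1) * P.Wstar) := by
  have h := P.U_div_ge'
  have hW := P.one_le_Wstar
  unfold cT
  rw [le_div_iff₀ (by positivity)]
  rw [le_div_iff₀ (by positivity)] at h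
  have h50 : (2 : ℝ) * 2 ^ 14 ≤ 2 ^ (49 * (d + 1)) := by
    calc (2 : ℝ) * 2 ^ 14 = 2 ^ 15 := by norm_num
      _ ≤ 2 ^ (49 * (d + 1)) := pow_le_pow_right₀ (by norm_num) (by omega)
  calc (2 : ℝ) * (2 ^ 14 * 2 ^ (d + 1) * P.Wstar) = (2 * 2 ^ 14) * (2 ^ (d + 1) * P.Wstar) := by ring
    _ ≤ 2 ^ (49 * (d + 1)) * (2 ^ (d + 1) * P.Wstar) := by gcongr
    _ ≤ P.U := h

/-- `U/(2 c_T 2ᵐ W⋆) ≤ T` (the floor costs at most a factor `2`). [folklore] -/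
theorem T_ge : P.U / (cT * 2 ^ (d + 1) * P.Wstar) / 2 ≤ P.T := by
  unfold T
  have h1 := Nat.lt_floor_add_one (P.U / (cT * 2 ^ (d + 1) * P.Wstar))
  have h2 := P.two_le_U_div_cT
  linarith

/-- `1 ≤ T`. [folklore] -/
theorem one_le_T : 1 ≤ P.T := by
  have h := P.T_ge
  have h2 := P.two_le_U_div_cT
  have : (1 : ℝ) ≤ P.T := by linarith
  exact_mod_cast this

/-! ### `L_θ`, `Lⱼ`, `J₀` -/

/-- The denominator of `L_θ` is positive. [folklore] -/
theorem den_Lθ_pos : 0 < cL' * mR d * 2 ^ (d + 2) * P.S₀ * P.Vθ := by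
  unfold cL'; have := (mR_pos P); have := P.S₀_pos; have := P.one_le_Vθ; positivity

/-- `L_θ ≤ U/(c_L' m 2^{m+1} S₀ V_θ)`. [folklore] -/
theorem Lθ_le : (P.Lθ : ℝ) ≤ P.U / (cL' * mR d * 2 ^ (d + 2) * P.S₀ * P.Vθ) := by
  unfold Lθ
  exact Nat.floor_le (div_nonneg P.U_pos.le P.den_Lθ_pos.le)

/-- `U/(c_L' m 2^{m+1} S₀ V_θ) ≥ 2`. [folklore] -/
theorem two_le_U_div_Lθden : (2 : ℝ) ≤ P.U / (cL' * mR d * 2 ^ (d + 2) * P.S₀ * P.Vθ) := by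
  rw [le_div_iff₀ P.den_Lθ_pos]
  have h := P.U_div_ge
  rw [le_div_iff₀ (by positivity)] at h
  have hS := P.S₀_le
  have hm := (two_le_mR P)
  have hG : 11 * mR d ≤ P.G := P.eleven_mR_le_G
  have hVθ := P.one_le_Vθ
  have hW := P.one_le_Wstar
  have hV1 : 1 ≤ ∏ j, P.V j := by
    have : ∏ _j : Fin d, (1 : ℝ) ≤ ∏ j, P.V j := prod_le_prod (fun _ _ => zero_le_one) fun j _ => P.hV j
    simpa using this
  -- `2 · c_L' m 2^{d+2} S₀ Vθ ≤ 2^{29} m² W⋆ Vθ ≤ 2^{49m} G (∏V) Vθ W⋆ 2^{d+1}`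
  unfold cL' cS at *
  have hmm : mR d * mR d ≤ 2 ^ (2 * (d + 1)) := by
    have hmle : mR d ≤ 2 ^ (d + 1) := by
      unfold mR
      have : ((d : ℝ) + 1) = ((d + 1 : ℕ) : ℝ) := by push_cast; ring
      rw [this]; exact_mod_cast (Nat.lt_two_pow_self).le
    calc mR d * mR d ≤ 2 ^ (d + 1) * 2 ^ (d + 1) := mul_le_mul hmle hmle (mR_pos P).le (by positivity)
      _ = 2 ^ (2 * (d + 1)) := by rw [← pow_add]; ring_nf
  calc 2 * (2 ^ 12 * mR d * 2 ^ (d + 2) * (P.S₀ : ℝ) * P.Vθ)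
      ≤ 2 * (2 ^ 12 * mR d * 2 ^ (d + 2) * (2 * (2 ^ 13 * mR d * P.Wstar)) * P.Vθ) := by gcongr
    _ = 2 ^ 28 * (mR d * mR d) * (2 ^ (d + 1) * P.Wstar * P.Vθ) := by ring
    _ ≤ 2 ^ 28 * 2 ^ (2 * (d + 1)) * (2 ^ (d + 1) * P.Wstar * P.Vθ) := by gcongr
    _ = 2 ^ (28 + 2 * (d + 1)) * 1 * 1 * P.Vθ * P.Wstar * 2 ^ (d + 1) := by rw [pow_add]; ring
    _ ≤ 2 ^ (49 * (d + 1)) * P.G * (∏ j, P.V j) * P.Vθ * P.Wstar * 2 ^ (d + 1) := by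
        have hG0 : 0 ≤ P.G := by linarith
        have hG1 : 1 ≤ P.G := by linarith
        have hpow : (2 : ℝ) ^ (28 + 2 * (d + 1)) ≤ 2 ^ (49 * (d + 1)) :=
          pow_le_pow_right₀ (by norm_num) (by omega)
        gcongr
    _ = 2 ^ (49 * (d + 1)) * P.G * ((∏ j, P.V j) * P.Vθ) * P.Wstar * 2 ^ (d + 1) := by ring
    _ ≤ P.U := h

/-- `U/(2 c_L' m 2^{m+1} S₀ V_θ) ≤ L_θ`. [folklore] -/
theorem Lθ_ge : P.U / (cL' * mR d * 2 ^ (d + 2) * P.S₀ * P.Vθ) / 2 ≤ P.Lθ := by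
  unfold Lθ
  have h1 := Nat.lt_floor_add_one (P.U / (cL' * mR d * 2 ^ (d + 2) * P.S₀ * P.Vθ))
  have h2 := P.two_le_U_div_Lθden
  linarith

/-- `1 ≤ L_θ`. [folklore] -/
theorem one_le_Lθ : 1 ≤ P.Lθ := by
  have h := P.Lθ_ge
  have h2 := P.two_le_U_div_Lθden
  have : (1 : ℝ) ≤ P.Lθ := by linarith
  exact_mod_cast this

/-- `L_θ ≤ Lⱼ` (the eliminated logarithm has the largest size, hence the smallest range). [folklore] -/
theorem Lθ_le_L (j : Fin d) : P.Lθ ≤ P.L j := by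
  unfold Lθ L
  apply Nat.floor_mono
  apply div_le_div_of_nonneg_left P.U_pos.le
  · unfold cL'; have := (mR_pos P); have := P.S₀_pos; have := P.hV j; positivity
  · have : P.V j ≤ P.Vθ := (P.hVf j).trans P.hVfθ
    have h0 : 0 ≤ cL' * mR d * 2 ^ (d + 2) * (P.S₀ : ℝ) := by
      unfold cL'; have := (mR_pos P); have := P.S₀_pos; positivity
    exact mul_le_mul_of_nonneg_left this h0

/-- `L_θ < 2^{J₀}`. [folklore] -/
theorem Lθ_lt_two_pow : P.Lθ < 2 ^ P.J₀ := Nat.lt_pow_succ_log_self one_lt_two _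

/-- `2^{J₀} ≤ 2 L_θ`. [folklore] -/
theorem two_pow_le : 2 ^ P.J₀ ≤ 2 * P.Lθ := by
  unfold J₀
  rw [pow_succ]
  have := Nat.pow_log_le_self 2 (show P.Lθ ≠ 0 by have := P.one_le_Lθ; omega)
  omega

/-- `1 ≤ J₀`. [folklore] -/
theorem one_le_J₀ : 1 ≤ P.J₀ := Nat.le_add_left 1 _

/-- **`T ≥ 2¹¹ m² V_θ L_θ`**: the derivatives outnumber the smallest exponent range by the
factor `c_L' c_S m² V_θ/c_T` — the source of all the room in the numerical conditions
(`T/2^{J₀} ≥ 2¹⁰ m² V_θ`). [cite: Waldschmidt1980, (3.10) and (3.14) (p. 265)] -/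
theorem T_ge_Lθ : (2 : ℝ) ^ 11 * mR d ^ 2 * P.Vθ * P.Lθ ≤ P.T := by
  have hT := P.T_ge
  have hL := P.Lθ_le
  have hS := P.S₀_ge
  have hm := (mR_pos P)
  have hVθ := P.one_le_Vθ
  have hW := P.one_le_Wstar
  have hU := P.U_pos
  refine le_trans ?_ hT
  -- `2¹¹ m² Vθ · U/(c_L' m 2^{d+2} S₀ Vθ) ≤ U/(2 c_T 2^{d+1} W⋆)` since `S₀ ≥ c_S m W⋆`
  unfold cT cL' cS at *
  have hden : 0 < (2 : ℝ) ^ 12 * mR d * 2 ^ (d + 2) * P.S₀ * P.Vθ := by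
    have := P.S₀_pos; positivity
  calc (2 : ℝ) ^ 11 * mR d ^ 2 * P.Vθ * P.Lθ
      ≤ 2 ^ 11 * mR d ^ 2 * P.Vθ * (P.U / (2 ^ 12 * mR d * 2 ^ (d + 2) * P.S₀ * P.Vθ)) := by gcongr
    _ = P.U * (mR d / (2 * 2 ^ (d + 2) * P.S₀)) := by field_simp
    _ ≤ P.U * (mR d / (2 * 2 ^ (d + 2) * (2 ^ 13 * mR d * P.Wstar))) := by
        apply mul_le_mul_of_nonneg_left _ hU.le
        apply div_le_div_of_nonneg_left hm.le (by positivity)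
        gcongr
    _ = P.U / (2 ^ 14 * 2 ^ (d + 1) * P.Wstar) / 2 := by field_simp; ring

end W80Par

end Literature.NumberTheory.Transcendental.Waldschmidt1980

end
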